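import Summits.CriticalPhenomena.PercolationContinuityZ3.Theorems.PercNearOneGluingNoHeavyLowerTailSahiCubePhi
import Mathlib.Tactic.Linarith
import Mathlib.Tactic.Ring
import HarnessLib

/-!
# `NoHeavyLowerTail` (crux stmt-CriticalPhenomena-4575), master-family line P2: **POLARISED Φ-POSITIVITY** — the `G3` pair kernel summed against
# ANY nonnegative box-constant kernel is nonnegative; in particular the three `p_e`-Bernstein components of `Φ` are separately `≥ 0`

Support file (seat `prim-masterthm-p2`, gen 10; `--supports stmt-CriticalPhenomena-4575`); no definition, no sorry.  Memo SAHI-ROUTE.md §4.33.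

`SahiBox.phi_nonneg` (p264262, G3) proves `Σ_{x,y} w(x)w(y)·T(x,y) ≥ 0`, `T(x,y) = g_x[(2−r_x)Y_x − F_yH_x − (1−r_y)Y_y]`, for a log-modular probability weight
by regrouping the pairs `(x,y)` along the fibres of `(x,y) ↦ (x∩y, x∪y)` (boxes with the antipodal pairing) and the antipodal lemma on each box
(`SahiBox.fiber_sum_nonneg`).  The only property of the weight `w(x)w(y)` used is that it is NONNEGATIVE AND CONSTANT ON EACH FIBRE.  Hence:
* `pair_sum_nonneg_of_boxKernel` — for every kernel `K(a,b) ≥ 0`, **`Σ_{x,y} K(x∩y, x∪y)·T(x,y) ≥ 0`** (same hypotheses on `F, H, Y, r, g` as G3);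
* `phi_polarised_nonneg` — for a log-modular `w ≥ 0` and ANY set `S` of "(bottom, top)" pairs, the partial sum of `w(x)w(y)T(x,y)` over the pairs whose box
  `(x∩y, x∪y)` lies in `S` is `≥ 0`; with `S = {e ∈ top ∖ bottom}`, `{e ∈ bottom}`, `{e ∉ top}` (`phi_polarised_coord_mixed/_top/_bottom`) these are, up to the
  factors `2t(1−t), t², (1−t)²` (`t = p_e`) carried by `w`, the three BERNSTEIN COMPONENTS of `Φ` in the direction `e`: each is nonnegative on its own.
WHY (memo §4.32(l), §4.33): after gen 10 the live targets for Kahn's C_3 on cubes are the SELECTION statement `DTEGCWeak` and the ∀-statement BGC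
("every coordinate has nonnegative middle Bernstein coefficients", master-conj; = one-direction comb positivity).  On CLASS T the ratio `ρ` is `p_γ`-free and the
kernel `T` is `p_γ`-free, so this file's lemma polarises the whole class-T proof: **E_3 of a class-T triple is comb-positive in the variables of any one
pairwise-shared block** (paper theorem, §4.33; exact check on 300 random class-T triples, blocks up to 4 bits) — in particular BGC holds on class T at every
coordinate.  This file is the kernel of that statement; the block/Bernstein bookkeeping is left to the assembly file.
-/

noncomputable section

open scoped Classical

namespace Summit.CriticalPhenomena.PercolationContinuityZ3.Theorems

namespace SahiBox

open Finset

variable {ι : Type} [DecidableEq ι] [Fintype ι]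

/-- **Polarised `G3`**: the pair kernel of `phi_nonneg` summed against ANY nonnegative kernel that depends on `(x,y)` only through the box
`(x ∩ y, x ∪ y)` is nonnegative. [this work] -/
theorem pair_sum_nonneg_of_boxKernel (K : Finset ι → Finset ι → ℝ) (hK : ∀ a b, 0 ≤ K a b)
    {F H Y r g : Finset ι → ℝ} (hF : Monotone F) (hF0 : ∀ c, 0 ≤ F c)
    (hH : Monotone H) (hH0 : ∀ c, 0 ≤ H c) (hY : Monotone Y) (hFH : ∀ c, F c * H c ≤ Y c)
    (hr0 : ∀ c, 0 ≤ r c) (hr1 : ∀ c, r c ≤ 1) (hstar : ∀ c c', c' ≤ c → F c' ≤ (1 - r c + r c') * F c)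
    (hg0 : ∀ c, 0 ≤ g c) (hg : Monotone g) :
    0 ≤ ∑ x, ∑ y, K (x ∩ y) (x ∪ y) * (g x * ((2 - r x) * Y x - F y * H x - (1 - r y) * Y y)) := by
  rw [← Finset.sum_product', Finset.univ_product_univ]
  rw [← Finset.sum_fiberwise_of_maps_to (s := (Finset.univ : Finset (Finset ι × Finset ι))) (t := Finset.univ)
    (g := fun p : Finset ι × Finset ι => (p.1 ∩ p.2, p.1 ∪ p.2)) (fun p _ => Finset.mem_univ _)]
  refine Finset.sum_nonneg fun q _ => ?_
  have hconst : ∀ p ∈ (Finset.univ : Finset (Finset ι × Finset ι)).filter (fun p => (p.1 ∩ p.2, p.1 ∪ p.2) = q),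
      K (p.1 ∩ p.2) (p.1 ∪ p.2) * (g p.1 * ((2 - r p.1) * Y p.1 - F p.2 * H p.1 - (1 - r p.2) * Y p.2)) =
        K q.1 q.2 * (g p.1 * ((2 - r p.1) * Y p.1 - F p.2 * H p.1 - (1 - r p.2) * Y p.2)) := by
    intro p hp
    have hq := (Finset.mem_filter.1 hp).2
    rw [← hq]
  rw [Finset.sum_congr rfl hconst, ← Finset.mul_sum]
  refine mul_nonneg (hK _ _) ?_
  have hfilt : ((Finset.univ : Finset (Finset ι × Finset ι)).filter fun p => (p.1 ∩ p.2, p.1 ∪ p.2) = q) =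
      (Finset.univ : Finset (Finset ι × Finset ι)).filter fun p => p.1 ∩ p.2 = q.1 ∧ p.1 ∪ p.2 = q.2 := by
    ext p
    simp only [Finset.mem_filter, Finset.mem_univ, true_and, Prod.ext_iff]
  rw [hfilt]
  exact fiber_sum_nonneg hF hF0 hH hH0 hY hFH hr0 hr1 hstar hg0 hg q.1 q.2

/-- **Partial sums of `Φ` over box classes.**  For a log-modular weight `w ≥ 0` and any predicate `S` on (bottom, top), the sum of
`w(x)w(y)T(x,y)` over the pairs whose box satisfies `S` is nonnegative. [this work] -/
theorem phi_polarised_nonneg (w : Finset ι → ℝ) (hw0 : ∀ x, 0 ≤ w x)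
    (hwmod : ∀ x y, w x * w y = w (x ∩ y) * w (x ∪ y)) (S : Finset ι → Finset ι → Prop) [∀ a b, Decidable (S a b)]
    {F H Y r g : Finset ι → ℝ} (hF : Monotone F) (hF0 : ∀ c, 0 ≤ F c)
    (hH : Monotone H) (hH0 : ∀ c, 0 ≤ H c) (hY : Monotone Y) (hFH : ∀ c, F c * H c ≤ Y c)
    (hr0 : ∀ c, 0 ≤ r c) (hr1 : ∀ c, r c ≤ 1) (hstar : ∀ c c', c' ≤ c → F c' ≤ (1 - r c + r c') * F c)
    (hg0 : ∀ c, 0 ≤ g c) (hg : Monotone g) :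
    0 ≤ ∑ x, ∑ y, (if S (x ∩ y) (x ∪ y) then w x * w y else 0) *
      (g x * ((2 - r x) * Y x - F y * H x - (1 - r y) * Y y)) := by
  have h := pair_sum_nonneg_of_boxKernel (fun a b => if S a b then w a * w b else 0)
    (fun a b => by by_cases hab : S a b <;> simp [hab, mul_nonneg (hw0 a) (hw0 b)])
    hF hF0 hH hH0 hY hFH hr0 hr1 hstar hg0 hg
  have heq : ∀ x y, (if S (x ∩ y) (x ∪ y) then w x * w y else 0) =
      (fun a b => if S a b then w a * w b else 0) (x ∩ y) (x ∪ y) := by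
    intro x y
    by_cases hS : S (x ∩ y) (x ∪ y) <;> simp [hS, hwmod x y]
  simp_rw [heq]
  exact h

/-- **The mixed `p_e`-component of `Φ` is nonnegative**: the sum over the pairs `(x,y)` that DIFFER at the coordinate `e` (boxes spanning `e`). [this work] -/
theorem phi_polarised_coord_mixed (w : Finset ι → ℝ) (hw0 : ∀ x, 0 ≤ w x)
    (hwmod : ∀ x y, w x * w y = w (x ∩ y) * w (x ∪ y)) (e : ι)
    {F H Y r g : Finset ι → ℝ} (hF : Monotone F) (hF0 : ∀ c, 0 ≤ F c)
    (hH : Monotone H) (hH0 : ∀ c, 0 ≤ H c) (hY : Monotone Y) (hFH : ∀ c, F c * H c ≤ Y c)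
    (hr0 : ∀ c, 0 ≤ r c) (hr1 : ∀ c, r c ≤ 1) (hstar : ∀ c c', c' ≤ c → F c' ≤ (1 - r c + r c') * F c)
    (hg0 : ∀ c, 0 ≤ g c) (hg : Monotone g) :
    0 ≤ ∑ x, ∑ y, (if e ∈ x ∪ y ∧ e ∉ x ∩ y then w x * w y else 0) *
      (g x * ((2 - r x) * Y x - F y * H x - (1 - r y) * Y y)) :=
  phi_polarised_nonneg w hw0 hwmod (fun a b => e ∈ b ∧ e ∉ a) hF hF0 hH hH0 hY hFH hr0 hr1 hstar hg0 hg

/-- **The top `p_e`-component of `Φ` is nonnegative**: the pairs with `e ∈ x ∩ y`. [this work] -/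
theorem phi_polarised_coord_top (w : Finset ι → ℝ) (hw0 : ∀ x, 0 ≤ w x)
    (hwmod : ∀ x y, w x * w y = w (x ∩ y) * w (x ∪ y)) (e : ι)
    {F H Y r g : Finset ι → ℝ} (hF : Monotone F) (hF0 : ∀ c, 0 ≤ F c)
    (hH : Monotone H) (hH0 : ∀ c, 0 ≤ H c) (hY : Monotone Y) (hFH : ∀ c, F c * H c ≤ Y c)
    (hr0 : ∀ c, 0 ≤ r c) (hr1 : ∀ c, r c ≤ 1) (hstar : ∀ c c', c' ≤ c → F c' ≤ (1 - r c + r c') * F c)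
    (hg0 : ∀ c, 0 ≤ g c) (hg : Monotone g) :
    0 ≤ ∑ x, ∑ y, (if e ∈ x ∩ y then w x * w y else 0) *
      (g x * ((2 - r x) * Y x - F y * H x - (1 - r y) * Y y)) :=
  phi_polarised_nonneg w hw0 hwmod (fun a _ => e ∈ a) hF hF0 hH hH0 hY hFH hr0 hr1 hstar hg0 hg

/-- **The bottom `p_e`-component of `Φ` is nonnegative**: the pairs with `e ∉ x ∪ y`. [this work] -/
theorem phi_polarised_coord_bottom (w : Finset ι → ℝ) (hw0 : ∀ x, 0 ≤ w x)
    (hwmod : ∀ x y, w x * w y = w (x ∩ y) * w (x ∪ y)) (e : ι)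
    {F H Y r g : Finset ι → ℝ} (hF : Monotone F) (hF0 : ∀ c, 0 ≤ F c)
    (hH : Monotone H) (hH0 : ∀ c, 0 ≤ H c) (hY : Monotone Y) (hFH : ∀ c, F c * H c ≤ Y c)
    (hr0 : ∀ c, 0 ≤ r c) (hr1 : ∀ c, r c ≤ 1) (hstar : ∀ c c', c' ≤ c → F c' ≤ (1 - r c + r c') * F c)
    (hg0 : ∀ c, 0 ≤ g c) (hg : Monotone g) :
    0 ≤ ∑ x, ∑ y, (if e ∉ x ∪ y then w x * w y else 0) *
      (g x * ((2 - r x) * Y x - F y * H x - (1 - r y) * Y y)) :=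
  phi_polarised_nonneg w hw0 hwmod (fun _ b => e ∉ b) hF hF0 hH hH0 hY hFH hr0 hr1 hstar hg0 hg

end SahiBox

end Summit.CriticalPhenomena.PercolationContinuityZ3.Theorems
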